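import Literature.NumberTheory.GaloisRepresentations.CentralInvolutionBreakProofs
import Literature.NumberTheory.GaloisRepresentations.EisensteinRootOrdProofs
import HarnessLib

/-!
# The one-slope Newton polygon: `n · v_𝔓(θ) = v_𝔓(c₀)`, square-root defects, and the index of
# an involution from an approximate square root in the base

`Proofs` file (theorems only, no definitions, no named facts) in topic
`NumberTheory/GaloisRepresentations`, landed by the seat of bsd.S15
(`Literature.NumberTheory.EllipticCurves.conductorNorm_eq_artinConductorNat_of_isElliptic`) as a
generic valuation brick for the Galois side of Ogg's formula above `2` (Silverman, *ATAEC*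
Thm. IV.11.1, `p = 2`, PDF p. 366): there every datum is the `𝔓`-adic order of an explicit
algebraic number of the `3`-division field or of its subfield `K(x(E[3]))`
(`ThreeTorsionCentralInvolutionSwanProofs`, `ThreeTorsionWildInertiaRootsProofs`,
`RamificationSquareTwoProofs`, `ThreeTorsionRadical*Proofs`), and the break `b` of the quadratic
layer `K(E[3]) = K(x(E[3]))(w)`, `w = 18(2y + a₁x + a₃)`, is a *square-root defect* of
`w² = 3Θ` in `K(x(E[3]))`.  This file certifies such orders from a single monic relation.

Let `B` be a Dedekind domain, `P ≠ 0` a prime, `v = v_P : B → ℕ∞` the tree's `ord`.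

* `natDegree_mul_ord_eq_of_forall_le` — **the one-slope lemma**: if
  `θⁿ + C_{n-1}θⁿ⁻¹ + ⋯ + C₀ = 0` in `B` with `v(C₀) = N` and `N (n - k) ≤ n v(C_k)` for all
  `k < n` (all the points `(k, v(C_k))` lie on or above the segment from `(0, N)` to `(n, 0)`),
  then **`n · v(θ) = N`**.  (Neukirch II (6.3) and the remark after it: the Newton polygon is a
  single segment iff all roots have the same value, and then that value is `v(C₀)/n`; here for
  one root `θ ∈ B` at one prime, with no splitting field and no irreducibility.)  The Eisenstein
  case `N = e`, `v(C_k) ≥ e` is `natDegree_mul_ord_root_eq` (`EisensteinRootOrdProofs`).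
* `natDegree_mul_ord_root_eq_ramificationIdx_mul` — the same over a ring of integers `R` below
  (`𝔭 = 𝔓 ∩ R`, `e = e(𝔓 ∣ 𝔭)`): `c₀ ∈ 𝔭ᵐ ∖ 𝔭ᵐ⁺¹` and `c_kⁿ ∈ 𝔭^{m(n-k)}` give
  **`n · v_𝔓(θ) = e · m`** — valuations above are read off ideal memberships below.
* `two_mul_ord_sub_eq_of_le` — **square roots**: `(w - s)² + 2s(w - s) - (w² - s²) = 0`, so
  **`2 v(w - s) = v(w² - s²)` as soon as `v(w² - s²) ≤ 2 v(2s)`**;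
  `two_mul_ord_sub_eq_of_smul_eq_neg` — and **unconditionally when an automorphism `σ` of `B`
  fixing `P` has `σw = -w`, `σs = s`** (`w + s = -σ(w - s)` has the order of `w - s`).
* `lowerIndex_eq_of_smul_eq_neg_of_ord_sq_sub_sq` (finite residue field, `σ ∈ G₁`) — hence the
  index of an element acting as `-1` on `w` is read off an **approximate square root `s` of `w²`
  fixed by `σ`** (e.g. in the subring fixed by `σ`): if `v(2w) = m` and `v(w² - s²) = 2n'` with
  `n'` prime to the residue characteristic, then **`i_G(σ) = (m - n') + 1`** — the solved form
  `lowerIndex_eq_of_smul_eq_neg` (`CentralInvolutionBreakProofs`) with its hypothesis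
  `v(w - t) = n'` replaced by a valuation of the element `w² - s²` of the smaller ring;
  `lowerIndex_eq_of_sq_eq_of_ord_sub_sq` is the same with `w² = A` named.  For the quadratic
  extension `M(√A)/M` in residue characteristic `2` this is the classical rule "the break is
  `v(2√A) - d/2` where `d = v_{M(√A)}(A - s²)` is the (odd-halved) square-root defect"
  (Serre, *Local Fields*, Ch. IV §1–§2; cf. Ch. XV §2 Exercise / Hecke's theorem on quadratic
  discriminants), in the form needed above `2` by the seats computing `b` and the four-group
  indices from `3Θ` and `A_k = c₄ - 12ωᵏ∛Δ`.

## References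

* J. Neukirch, *Algebraic Number Theory*, Grundlehren 322 (1999), Ch. II §6, Prop. (6.3) and the
  remark following its proof (one segment iff all roots have the same value). [NeukirchANT1999]
* J.-P. Serre, *Local Fields*, GTM 67 (1979), Ch. I §6 Prop. 17–18 (Eisenstein equations),
  Ch. IV §1 (`i_G`, Lemma 1), §2 Prop. 5. [SerreLocalFields1979]
* J. H. Silverman, *Advanced Topics in the Arithmetic of Elliptic Curves*, GTM 151 (1994),
  Thm. IV.11.1 (`p = 2`, PDF p. 366). [SilvermanATAEC1994]

## Design

Theorems only; `namespace Literature.NumberTheory.GaloisRepresentations`; the single-ring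
statements use the tree's `ord : B → ℕ∞` (`RamificationGalois`), the tower statement the
setting of `EisensteinRootOrdProofs` (`R` Dedekind with fraction field `K`, `L/K` finite
separable, `𝔓` a maximal ideal of `integralClosure R L`).  The arithmetic of the two slope
inequalities is isolated in two private lemmas over `ℕ`.  Axioms: `propext`, `Classical.choice`,
`Quot.sound`.
-/

noncomputable section

open scoped Classical Pointwise

namespace Literature.NumberTheory.GaloisRepresentations

/-! ### §0. The two slope inequalities in `ℕ` -/

/-- Below the segment: `k < n`, `n t < N`, `N (n - k) ≤ n a` give `n t + 1 ≤ a + k t`.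
[folklore] -/
private theorem slope_lt_aux {n k t N a : ℕ} (hk : k < n) (hlt : n * t < N)
    (hna : N * (n - k) ≤ n * a) : n * t + 1 ≤ a + k * t := by
  obtain ⟨d, rfl⟩ : ∃ d, n = k + d := ⟨n - k, by omega⟩
  have hd : k + d - k = d := by omega
  rw [hd] at hna
  have hdpos : 0 < d := by omega
  have h1 : (k + d) * (d * t) < (k + d) * a :=
    calc (k + d) * (d * t) = ((k + d) * t) * d := by ring
      _ < N * d := mul_lt_mul_of_pos_right hlt hdpos
      _ ≤ (k + d) * a := hna
  have h2 : d * t < a := Nat.lt_of_mul_lt_mul_left h1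
  have h3 : (k + d) * t = k * t + d * t := by ring
  rw [h3]
  omega

/-- Above the constant term: `1 ≤ k < n`, `N < n t`, `N (n - k) ≤ n a` give `N + 1 ≤ a + k t`.
[folklore] -/
private theorem slope_gt_aux {n k t N a : ℕ} (hk : k < n) (hk1 : 1 ≤ k) (hgt : N < n * t)
    (hna : N * (n - k) ≤ n * a) : N + 1 ≤ a + k * t := by
  obtain ⟨d, rfl⟩ : ∃ d, n = k + d := ⟨n - k, by omega⟩
  have hd : k + d - k = d := by omega
  rw [hd] at hna
  -- `k N < k (k + d) t`
  have h1 : k * N < k * ((k + d) * t) := mul_lt_mul_of_pos_left hgt hk1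
  by_contra hle
  push Not at hle
  have hle' : a + k * t ≤ N := by omega
  have h2 : (k + d) * (a + k * t) ≤ (k + d) * N := Nat.mul_le_mul_left (k + d) hle'
  nlinarith [h1, h2, hna]

/-! ### §1. The one-slope lemma in a Dedekind domain -/

section OneSlope

variable {B : Type*} [CommRing B] [IsDedekindDomain B] (P : Ideal B) [P.IsPrime]

/-- **The one-slope Newton polygon.**  Let `P ≠ 0` be a prime of a Dedekind domain `B` and let
`θ ∈ B` satisfy `θⁿ + Σ_{k<n} C_k θ^k = 0` (`n ≥ 1`) with `v_P(C₀) = N` and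
`N (n - k) ≤ n · v_P(C_k)` for every `k < n` — every point `(k, v_P(C_k))` lies on or above the
segment joining `(0, N)` to `(n, 0)`.  Then **`n · v_P(θ) = N`**.  Proof: if `n v(θ) < N` every
term `C_kθ^k` has order `> n v(θ) = v(θⁿ)`; if `n v(θ) > N` the constant term strictly dominates
the others, so `v(θⁿ) = v(Σ C_kθ^k) = N`; both are absurd.
[cite: NeukirchANT1999, Ch. II §6 Prop. (6.3) and the remark after its proof] -/
theorem natDegree_mul_ord_eq_of_forall_le (hP : P ≠ ⊥) {θ : B} {n : ℕ} (hn : 0 < n)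
    {C : ℕ → B} (hθ : θ ^ n + ∑ k ∈ Finset.range n, C k * θ ^ k = 0) {N : ℕ}
    (hC₀ : ord P (C 0) = N) (hC : ∀ k < n, ((N * (n - k) : ℕ) : ℕ∞) ≤ n * ord P (C k)) :
    (n : ℕ∞) * ord P θ = N := by
  -- `θ ≠ 0`
  have hθ0 : θ ≠ 0 := by
    rintro rfl
    have hsum : ∑ k ∈ Finset.range n, C k * (0 : B) ^ k = C 0 := by
      rw [Finset.sum_eq_single_of_mem 0 (Finset.mem_range.mpr hn)]
      · simp
      · intro k _ hk0
        rw [zero_pow hk0, mul_zero]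
    rw [zero_pow hn.ne', zero_add, hsum] at hθ
    rw [hθ, ord_zero] at hC₀
    exact ENat.top_ne_coe N hC₀
  obtain ⟨t, ht⟩ := exists_ord_eq_natCast P hP hθ0
  rw [ht]
  have hrel : θ ^ n = -(∑ k ∈ Finset.range n, C k * θ ^ k) := by linear_combination hθ
  have hordn : ord P (θ ^ n) = ((n * t : ℕ) : ℕ∞) := by
    rw [ord_pow P hP, ht]; push_cast; ring
  -- finite orders of the non-zero coefficients, with the slope inequality in `ℕ`
  have hcoef : ∀ k < n, C k ≠ 0 → ∃ a : ℕ, ord P (C k) = a ∧ N * (n - k) ≤ n * a := by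
    intro k hk hCk
    obtain ⟨a, ha⟩ := exists_ord_eq_natCast P hP hCk
    refine ⟨a, ha, ?_⟩
    have h := hC k hk
    rw [ha] at h
    exact_mod_cast h
  rcases Nat.lt_trichotomy (n * t) N with hlt | heq | hgt
  · -- `n t < N`
    exfalso
    have hmem : ∀ k ∈ Finset.range n, C k * θ ^ k ∈ P ^ (n * t + 1) := by
      intro k hk
      rw [Finset.mem_range] at hk
      by_cases hCk : C k = 0
      · rw [hCk, zero_mul]; exact zero_mem _
      obtain ⟨a, ha, hna⟩ := hcoef k hk hCk
      rw [mem_pow_iff_le_ord, ord_mul P hP, ord_pow P hP, ha, ht]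
      exact_mod_cast slope_lt_aux hk hlt hna
    have hsum : ∑ k ∈ Finset.range n, C k * θ ^ k ∈ P ^ (n * t + 1) := Ideal.sum_mem _ hmem
    have hθn : θ ^ n ∈ P ^ (n * t + 1) := by
      rw [hrel]; exact (Ideal.neg_mem_iff _).mpr hsum
    have h := (mem_pow_iff_le_ord P).mp hθn
    rw [hordn] at h
    have : n * t + 1 ≤ n * t := by exact_mod_cast h
    omega
  · exact_mod_cast heq
  · -- `n t > N`
    exfalso
    set tail := ∑ k ∈ Finset.range n \ {0}, C k * θ ^ k with htail
    have htail_mem : tail ∈ P ^ (N + 1) := by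
      refine Ideal.sum_mem _ fun k hk ↦ ?_
      rw [Finset.mem_sdiff, Finset.mem_range, Finset.mem_singleton] at hk
      by_cases hCk : C k = 0
      · rw [hCk, zero_mul]; exact zero_mem _
      obtain ⟨a, ha, hna⟩ := hcoef k hk.1 hCk
      rw [mem_pow_iff_le_ord, ord_mul P hP, ord_pow P hP, ha, ht]
      exact_mod_cast slope_gt_aux hk.1 (Nat.one_le_iff_ne_zero.mpr hk.2) hgt hna
    have hsplit : ∑ k ∈ Finset.range n, C k * θ ^ k = C 0 + tail := by
      rw [htail, ← Finset.sum_sdiff (Finset.singleton_subset_iff.mpr (Finset.mem_range.mpr hn)),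
        Finset.sum_singleton, pow_zero, mul_one, add_comm]
    have hordsum : ord P (∑ k ∈ Finset.range n, C k * θ ^ k) = N := by
      rw [hsplit, add_comm]
      have hlt' : ord P (C 0) < ord P tail := by
        rw [hC₀]
        exact lt_of_lt_of_le (by exact_mod_cast Nat.lt_succ_self N)
          ((mem_pow_iff_le_ord P).mp htail_mem)
      rw [ord_add_eq_of_lt P hlt', hC₀]
    have key : ord P (θ ^ n) = N := by rw [hrel, ord_neg, hordsum]
    rw [hordn] at key
    have : n * t = N := by exact_mod_cast key
    omega

/-! ### §2. Square roots -/

/-- **`2 v(w - s) = v(w² - s²)` under the slope condition `v(w² - s²) ≤ 2 v(2s)`**: the element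
`θ = w - s` satisfies `θ² + 2s·θ + (s² - w²) = 0`, a one-slope equation.  (Typical use in
residue characteristic `2`: `s` an approximate square root of `A = w²` with `v(A - s²)` small
compared to `2v(2s)`.) [cite: NeukirchANT1999, Ch. II §6 Prop. (6.3)] -/
theorem two_mul_ord_sub_eq_of_le (hP : P ≠ ⊥) {w s : B} {N : ℕ}
    (hN : ord P (w ^ 2 - s ^ 2) = N) (hle : (N : ℕ∞) ≤ 2 * ord P (2 * s)) :
    2 * ord P (w - s) = N := by
  have h := natDegree_mul_ord_eq_of_forall_le P hP (θ := w - s) (n := 2) two_pos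
    (C := fun k ↦ if k = 0 then s ^ 2 - w ^ 2 else 2 * s) ?_ (N := N) ?_ ?_
  · exact_mod_cast h
  · simp only [Finset.sum_range_succ, Finset.sum_range_zero, zero_add, if_true,
      one_ne_zero, if_false, pow_zero, mul_one, pow_one]
    ring
  · simp only [if_true]
    rw [show s ^ 2 - w ^ 2 = -(w ^ 2 - s ^ 2) by ring, ord_neg, hN]
  · intro k hk
    interval_cases k
    · simp only [if_true, Nat.sub_zero]
      rw [show s ^ 2 - w ^ 2 = -(w ^ 2 - s ^ 2) by ring, ord_neg, hN]
      push_cast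
      rw [mul_comm]
    · simp only [one_ne_zero, if_false]
      simpa using hle

variable {G : Type*} [Group G] [MulSemiringAction G B]

/-- **`2 v(w - s) = v(w² - s²)` for `σw = -w`, `σs = s`, `σP = P`**: `w² - s² = (w - s)(w + s)`
and `w + s = -σ(w - s)` has the same order as `w - s` (`ord_smul`).  No slope condition.
[cite: SerreLocalFields1979, Ch. I §7 (the decomposition group preserves v_𝔓)] -/
theorem two_mul_ord_sub_eq_of_smul_eq_neg (hP : P ≠ ⊥) {σ : G} (hσ : σ • P = P) {w s : B}
    (hw : σ • w = -w) (hs : σ • s = s) : 2 * ord P (w - s) = ord P (w ^ 2 - s ^ 2) := by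
  have h1 : w ^ 2 - s ^ 2 = (w - s) * -(σ • (w - s)) := by rw [smul_sub, hw, hs]; ring
  rw [h1, ord_mul P hP, ord_neg, ord_smul P hσ, two_mul]

end OneSlope

/-! ### §3. The index of an involution from an approximate square root in the base -/

section Index

variable {B : Type*} [CommRing B] [IsDedekindDomain B] {P : Ideal B} [P.IsMaximal]
  {G : Type*} [Group G] [MulSemiringAction G B] [Finite (B ⧸ P)]

/-- **`i_G(σ) = v(2w) - v(w² - s²)/2 + 1`.**  In the setting of `lowerIndex_eq_of_smul_eq_neg`
(`B` Dedekind acted on by `G`, `P ≠ 0` maximal with finite residue field, `σ ∈ G₁`), let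
`σw = -w`, `σs = s`, `v_P(2w) = m` and `v_P(w² - s²) = 2n'` with `n'` a unit modulo `P` (in
residue characteristic `2`: `n'` odd, i.e. `v_P(w² - s²) ≡ 2 (mod 4)`).  Then `n' ≤ m` and
**`i_G(σ) = (m - n') + 1`**: indeed `v_P(w - s) = n'` (`two_mul_ord_sub_eq_of_smul_eq_neg`), and
`lowerIndex_eq_of_smul_eq_neg` applies with `t = s`.  So the break `b = i_G(σ) - 1 = m - n'` of
the involution is read off one valuation of an element `w² - s²` of the ring fixed by `σ`.
[cite: SerreLocalFields1979, Ch. IV §1 (i_G, Lemma 1) and §2 Prop. 5] -/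
theorem lowerIndex_eq_of_smul_eq_neg_of_ord_sq_sub_sq (hP : P ≠ ⊥) {σ : G}
    (hσ : σ ∈ P.ramificationSubgroup G 1) {w s : B} (hw : σ • w = -w) (hs : σ • s = s)
    {m n : ℕ} (h2w : ord P (2 * w) = m) (hsq : ord P (w ^ 2 - s ^ 2) = ((2 * n : ℕ) : ℕ∞))
    (hn : (n : B) ∉ P) : n ≤ m ∧ lowerIndex P G σ = ((m - n : ℕ) : ℕ∞) + 1 := by
  have hσP : σ • P = P := hσ.1
  have h2 := two_mul_ord_sub_eq_of_smul_eq_neg P hP hσP hw hs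
  rw [hsq] at h2
  have hx : ord P (w - s) = n := by
    have hfin : ord P (w - s) ≠ ⊤ := by
      intro htop
      rw [htop] at h2
      exact ENat.top_ne_coe (2 * n) (by simpa using h2)
    obtain ⟨x, hx⟩ := ENat.ne_top_iff_exists.mp hfin
    rw [← hx] at h2 ⊢
    have h2' : 2 * x = 2 * n := by exact_mod_cast h2
    have : x = n := by omega
    rw [this]
  exact lowerIndex_eq_of_smul_eq_neg hP hσ hw hs h2w hx hn

/-- **The index of an involution from a square-root defect in the base**, named form: `w² = A`,
`σw = -w`, and `s` fixed by `σ` with `v_P(A - s²) = 2n'`, `n'` a unit mod `P`, `v_P(2w) = m`: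
**`i_G(σ) = (m - n') + 1`**.  For `M(√A)/M` quadratic in residue characteristic `2` with `σ` its
involution and `s ∈ M`: the break is `b = v(2√A) - n'`.
[cite: SerreLocalFields1979, Ch. IV §1 (i_G, Lemma 1) and §2 Prop. 5] -/
theorem lowerIndex_eq_of_sq_eq_of_ord_sub_sq (hP : P ≠ ⊥) {σ : G}
    (hσ : σ ∈ P.ramificationSubgroup G 1) {w A s : B} (hA : w ^ 2 = A) (hw : σ • w = -w)
    (hs : σ • s = s) {m n : ℕ} (h2w : ord P (2 * w) = m)
    (hsq : ord P (A - s ^ 2) = ((2 * n : ℕ) : ℕ∞)) (hn : (n : B) ∉ P) :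
    n ≤ m ∧ lowerIndex P G σ = ((m - n : ℕ) : ℕ∞) + 1 := by
  subst hA
  exact lowerIndex_eq_of_smul_eq_neg_of_ord_sq_sub_sq hP hσ hw hs h2w hsq hn

end Index

/-! ### §4. The one-slope lemma over a ring of integers below -/

section Tower

variable (R : Type*) {K L : Type*} [CommRing R] [IsDedekindDomain R] [Field K] [Field L]
  [Algebra R K] [IsFractionRing R K] [Algebra R L] [Algebra K L] [IsScalarTower R K L]
  [FiniteDimensional K L] [Algebra.IsSeparable K L]
  (𝔓 : Ideal (integralClosure R L)) [𝔓.IsMaximal]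

include K in
/-- **`n · v_𝔓(θ) = e(𝔓 ∣ 𝔭) · m` from a one-slope equation with coefficients below.**  If
`θⁿ + Σ_{k<n} c_k θ^k = 0` with `c_k ∈ R`, `c₀ ∈ 𝔭ᵐ ∖ 𝔭ᵐ⁺¹` (`𝔭 = 𝔓 ∩ R`) and
`c_kⁿ ∈ 𝔭^{m(n-k)}` for all `k < n` (i.e. `n v_𝔭(c_k) ≥ m (n - k)`: one slope `-m/n`), then
`n · v_𝔓(θ) = e · m` with `e = e(𝔓 ∣ 𝔭)` (`ramificationIdx'`), at *every* `𝔓` above `𝔭`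
(`v_𝔓(c) = e v_𝔭(c)` on `R`, `ord_algebraMap`, then `natDegree_mul_ord_eq_of_forall_le`).  The
case `m = 1` is the Eisenstein lemma `natDegree_mul_ord_root_eq`.
[cite: NeukirchANT1999, Ch. II §6 Prop. (6.3)] [cite: SerreLocalFields1979, Ch. I §6 Prop. 17] -/
theorem natDegree_mul_ord_root_eq_ramificationIdx_mul (h𝔓 : 𝔓 ≠ ⊥) {θ : integralClosure R L}
    {n : ℕ} (hn : 0 < n) {c : ℕ → R}
    (hθ : θ ^ n + ∑ k ∈ Finset.range n, algebraMap R _ (c k) * θ ^ k = 0) {m : ℕ}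
    (hc₀ : c 0 ∈ (𝔓.under R) ^ m) (hc₀' : c 0 ∉ (𝔓.under R) ^ (m + 1))
    (hc : ∀ k < n, c k ^ n ∈ (𝔓.under R) ^ (m * (n - k))) :
    (n : ℕ∞) * ord 𝔓 θ = (((𝔓.under R).ramificationIdx' 𝔓 * m : ℕ) : ℕ∞) := by
  haveI : IsDedekindDomain (integralClosure R L) := integralClosure.isDedekindDomain R K L
  have hp : 𝔓.under R ≠ ⊥ := Ideal.IsIntegral.comap_ne_bot _ h𝔓
  set e := (𝔓.under R).ramificationIdx' 𝔓 with he
  -- `v_𝔭(c₀) = m`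
  have hord₀ : ord (𝔓.under R) (c 0) = m := by
    refine le_antisymm ?_ ((mem_pow_iff_le_ord _).mp hc₀)
    by_contra hlt
    push Not at hlt
    exact hc₀' ((mem_pow_iff_le_ord _).mpr (Order.add_one_le_of_lt hlt))
  refine natDegree_mul_ord_eq_of_forall_le 𝔓 h𝔓 hn hθ ?_ ?_
  · rw [ord_algebraMap (K := K) 𝔓 h𝔓, hord₀]
    push_cast
    rfl
  · intro k hk
    have h1 : ((m * (n - k) : ℕ) : ℕ∞) ≤ n * ord (𝔓.under R) (c k) := by
      rw [← ord_pow _ hp]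
      exact (mem_pow_iff_le_ord _).mp (hc k hk)
    rw [ord_algebraMap (K := K) 𝔓 h𝔓]
    calc ((e * m * (n - k) : ℕ) : ℕ∞) = (e : ℕ∞) * ((m * (n - k) : ℕ) : ℕ∞) := by
          push_cast; ring
      _ ≤ (e : ℕ∞) * (n * ord (𝔓.under R) (c k)) := by gcongr
      _ = n * (e * ord (𝔓.under R) (c k)) := by ring

end Tower

end Literature.NumberTheory.GaloisRepresentations

end
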